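import Summits.CriticalPhenomena.CardyFormulaZ2.Theorems.CardyComplexConeEdgePrecompactUFRSMerge
import Summits.CriticalPhenomena.CardyFormulaZ2.Theorems.CardyComplexConeEdgePrecompactUFRSStrands
import Summits.CriticalPhenomena.CardyFormulaZ2.Theorems.CardyComplexConeEdgePrecompactResponseStabilityReduction
import Literature.Probability.LatticeModels.FermionicObservableSums

/-!
# Structure of an INITIAL forward-response failure: the two start strands
(line `qkz-strip-boundary-arm` of crux `CardyComplexCone.EdgePrecompact`, stmt-CriticalPhenomena-11387;
item 3 of the road map for the uniform forward response stability "UFRS", INITIAL case, registered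
sub-goal `ufrs_initialStrands`)

Setting of UFRS: an admissible datum `E` of the Jordan Dobrushin domain `D`, its lattice translate
`E₁ = shiftData E w` (`‖E.δ w‖ < η`), ONE configuration `ω` read in the two completed configurations
`β₀ = E.bcBondConfig ω`, `β₁ = E₁.bcBondConfig ω`, and the orbits `O₀ = cornerOrbit β₀ a`,
`O₁ = cornerOrbit β₁ a'` of Smirnov's successor map from the two START corners `a`, `a'`. The landed
structure theorem `ufrs_failureStructure` (`…UFRSFailureStructure.lean`) splits a forward-response
failure into a LOCALISED case and an INITIAL case; in the latter the `β₀`-orbit of `a` re-enters the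
ball `B(E.δ v, ρ)` at time `n` through inner faces and NO index `m ≤ n` is synchronised with the
`β₁`-orbit of `a'`. This file proves the structure theorem of the INITIAL case (`ufrs_initialStrands`):

1. `a' = (a.1 + w, a.2)` is the translate of `a` (uniqueness of the start corner of the admissible
   translated datum, `existsUnique_startCorner`, and `isStartCorner_shiftData_iff`);
2. the `β₁`-orbit of `a'` has a RUN END `T` (`exists_runEnd`: no idle cycling, a start corner is not
   reached by a step from an inner face, `nextCorner_ne_start`);
3. both stretches `O₀ [0, n]`, `O₁ [0, T]` are simple (`cornerOrbit_injOn_stretch`, `cornerOrbit_injOn_run`);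
4. either the two stretches share no corner, or there is a FIRST contact `O₁ j = O₀ i` (first in `j`),
   at which the two turning sums differ by `2πℓ`, `ℓ ≠ 0` — both orbits start with the same face index
   and meet at one corner, so their turn counts agree modulo `4` (`turnCount_emod_four`), and they are
   not equal by the no-synchronisation hypothesis — and the contact is a passage through one of the two
   start corners (`j = 0` or `i = 0`) or a MERGE of the two dynamics: distinct predecessors with one
   target edge of different status in `β₀`/`β₁`, in the `3η`-collar of `∂D` (`ufrs_mergeCollar`).

References: S. Smirnov, C. R. Acad. Sci. Paris 333 (2001), §2 (the exploration process and its turning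
rule); G. Grimmett, *The Random-Cluster Model* (2006), §6.1.
-/

namespace Summit.CriticalPhenomena.CardyFormulaZ2.Cruxes.EdgePrecompact.QkzStripBoundaryArm

open MeasureTheory Filter Set Metric
open scoped Topology BigOperators Pointwise
open Literature.Probability.LatticeModels Literature.Probability.Percolation
open Literature.Probability.RandomPlanarGeometry (DobrushinDomain)
open Summit.CriticalPhenomena.CardyFormulaZ2.Theses.CardyComplexCone

noncomputable section

/-! ## The start corner of the translated datum -/

/-- **The start corner of the translate is the translated start corner.** For an admissible datum
`E`, a start corner `a` of `E` and a start corner `a'` of `shiftData E w`: `a' = (a.1 + w, a.2)`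
(the translate of `a` is a start corner of the translate, which is admissible and so has exactly one). -/
theorem eq_shift_of_isStartCorner {E : DiscreteDobrushin} (hE : E.IsZdAdmissible) {w : Site 2}
    {a a' : Site 2 × Fin 4} (ha : E.IsStartCorner a) (ha' : (shiftData E w).IsStartCorner a') :
    a' = (a.1 + w, a.2) := by
  have hb : (shiftData E w).IsStartCorner (a.1 + w, a.2) := (isStartCorner_shiftData_iff w E a).2 ha
  exact (DiscreteDobrushin.existsUnique_startCorner (isZdAdmissible_shiftData E w hE)).unique
    ⟨ha'.mem_zdArcA, ha'.mem_zdArcB, ha'.isOutEdge⟩ ⟨hb.mem_zdArcA, hb.mem_zdArcB, hb.isOutEdge⟩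

/-! ## The turning offset at a contact of two orbits -/

/-- **Turning sums at a contact differ by a multiple of `2π`.** If the `β₁`-orbit of `c₁` and the
`β₀`-orbit of `c₀` start with the same face index and meet, `O₁ c₁ j = O₀ c₀ i`, then the two darts
at the contact coincide, so the two turn counts agree modulo `4` (`turnCount_emod_four`: the face
index of a dart records its direction), i.e. the real turning sums differ by `2πℓ` for an integer `ℓ`. -/
theorem exists_sum_turnOf_sub_eq {β₀ β₁ : BondConfig (Site 2)} {c₀ c₁ : Site 2 × Fin 4} {i j : ℕ}
    (h2 : c₁.2 = c₀.2) (h : cornerOrbit β₁ c₁ j = cornerOrbit β₀ c₀ i) :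
    ∃ ℓ : ℤ, ∑ t ∈ Finset.range i, turnOf β₀ (cornerOrbit β₀ c₀ t) -
      ∑ t ∈ Finset.range j, turnOf β₁ (cornerOrbit β₁ c₁ t) = 2 * Real.pi * ℓ := by
  have hmod : turnCount β₀ c₀ i % 4 = turnCount β₁ c₁ j % 4 := by
    rw [turnCount_emod_four, turnCount_emod_four, h]
    simp only [dartDir, h2]
  obtain ⟨ℓ, hℓ⟩ : (4 : ℤ) ∣ turnCount β₀ c₀ i - turnCount β₁ c₁ j :=
    Int.dvd_of_emod_eq_zero (by omega)
  have e : Real.pi / 2 * ∑ t ∈ Finset.range i, (turnSign β₀ (cornerOrbit β₀ c₀ t) : ℝ) -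
      Real.pi / 2 * ∑ t ∈ Finset.range j, (turnSign β₁ (cornerOrbit β₁ c₁ t) : ℝ) =
      Real.pi / 2 * ((turnCount β₀ c₀ i - turnCount β₁ c₁ j : ℤ) : ℝ) := by
    simp only [turnCount, Int.cast_sub, Int.cast_sum]
    ring
  refine ⟨ℓ, ?_⟩
  rw [sum_turnOf_eq, sum_turnOf_eq, e, hℓ]
  push_cast
  ring

/-! ## The first contact of the two start strands -/

/-- **Contacts of the two start strands** (combinatorial core of `ufrs_initialStrands`, for arbitrary
dynamics `β₀, β₁`). Data: corners `c₀, c₁` with the same face index, the no-synchronisation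
hypothesis of the INITIAL case up to time `n` of the `β₀`-orbit of `c₀`, a good `β₁`-stretch
`O₁ c₁ [0, T]`, and a MERGE hypothesis (`hcollar`, in UFRS: `ufrs_mergeCollar`): distinct corners sent
to the same corner by the two dynamics have one target edge, of different status, and satisfy `Col`.
CONCLUSION: either `O₁ c₁ [0, T]` and `O₀ c₀ [0, n]` share no corner, or there is a first contact
`O₁ c₁ j = O₀ c₀ i` (first in `j`) with turning sums differing by `2πℓ`, `ℓ ≠ 0`, which is a passage
through `c₁` (`j = 0`, then `1 ≤ i`) or through `c₀` (`i = 0`, `1 ≤ j`), or a merge of the two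
dynamics at the distinct predecessors `O₀ c₀ (i - 1) ≠ O₁ c₁ (j - 1)`. -/
theorem initialContact {β₀ β₁ : BondConfig (Site 2)} {In₁ : Site 2 → Prop} {I : Set (Sym2 (Site 2))}
    {Col : Site 2 × Fin 4 → Prop} {c₀ c₁ : Site 2 × Fin 4} {n T : ℕ}
    (hcollar : ∀ p p' : Site 2 × Fin 4, p ≠ p' → nextCorner β₀ p = nextCorner β₁ p' →
      Col p ∧ cTgt p = cTgt p' ∧ ¬ (cTgt p ∈ β₀ ↔ cTgt p ∈ β₁))
    (h2 : c₁.2 = c₀.2)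
    (hinit : ∀ m k : ℕ, m ≤ n →
      (∀ i < k, cTgt (cornerOrbit β₁ c₁ i) ∉ I ∧ In₁ (cFace (cornerOrbit β₁ c₁ (i + 1)))) →
      cornerOrbit β₁ c₁ k = cornerOrbit β₀ c₀ m →
      ∑ i ∈ Finset.range k, turnOf β₁ (cornerOrbit β₁ c₁ i) ≠
        ∑ i ∈ Finset.range m, turnOf β₀ (cornerOrbit β₀ c₀ i))
    (hrun : ∀ i < T, cTgt (cornerOrbit β₁ c₁ i) ∉ I ∧ In₁ (cFace (cornerOrbit β₁ c₁ (i + 1)))) :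
    (∀ j ≤ T, ∀ i ≤ n, cornerOrbit β₁ c₁ j ≠ cornerOrbit β₀ c₀ i) ∨
    (∃ (j i : ℕ) (ℓ : ℤ), j ≤ T ∧ i ≤ n ∧ cornerOrbit β₁ c₁ j = cornerOrbit β₀ c₀ i ∧
      (∀ j' < j, ∀ i' ≤ n, cornerOrbit β₁ c₁ j' ≠ cornerOrbit β₀ c₀ i') ∧ ℓ ≠ 0 ∧
      ∑ t ∈ Finset.range i, turnOf β₀ (cornerOrbit β₀ c₀ t) -
        ∑ t ∈ Finset.range j, turnOf β₁ (cornerOrbit β₁ c₁ t) = 2 * Real.pi * ℓ ∧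
      ((j = 0 ∧ 1 ≤ i) ∨ (i = 0 ∧ 1 ≤ j) ∨ (1 ≤ j ∧ 1 ≤ i ∧
        cornerOrbit β₀ c₀ (i - 1) ≠ cornerOrbit β₁ c₁ (j - 1) ∧
        cTgt (cornerOrbit β₀ c₀ (i - 1)) = cTgt (cornerOrbit β₁ c₁ (j - 1)) ∧
        ¬ (cTgt (cornerOrbit β₀ c₀ (i - 1)) ∈ β₀ ↔ cTgt (cornerOrbit β₀ c₀ (i - 1)) ∈ β₁) ∧
        Col (cornerOrbit β₀ c₀ (i - 1))))) := by
  classical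
  by_cases hcontact : ∃ j, j ≤ T ∧ ∃ i ≤ n, cornerOrbit β₁ c₁ j = cornerOrbit β₀ c₀ i
  · right
    -- the first contact in `j`
    obtain ⟨j, hjT, ⟨i, hin, hEq⟩, hmin⟩ : ∃ j, j ≤ T ∧
        (∃ i ≤ n, cornerOrbit β₁ c₁ j = cornerOrbit β₀ c₀ i) ∧
        ∀ j' < j, ∀ i' ≤ n, cornerOrbit β₁ c₁ j' ≠ cornerOrbit β₀ c₀ i' :=
      ⟨Nat.find hcontact, (Nat.find_spec hcontact).1, (Nat.find_spec hcontact).2,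
        fun j' hj' i' hi' h' => Nat.find_min hcontact hj'
          ⟨le_trans hj'.le (Nat.find_spec hcontact).1, i', hi', h'⟩⟩
    -- the turning offset `2πℓ`, `ℓ ≠ 0` by the no-synchronisation hypothesis at `(i, j)`
    obtain ⟨ℓ, hℓ⟩ := exists_sum_turnOf_sub_eq h2 hEq
    have hℓ0 : ℓ ≠ 0 := by
      rintro rfl
      refine hinit i j hin (fun t ht => hrun t (lt_of_lt_of_le ht hjT)) hEq ?_
      simp only [Int.cast_zero, mul_zero, sub_eq_zero] at hℓ
      exact hℓ.symm
    refine ⟨j, i, ℓ, hjT, hin, hEq, hmin, hℓ0, hℓ, ?_⟩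
    rcases Nat.eq_zero_or_pos j with hj0 | hj1
    · -- passage through `c₁`; `i = 0` too would synchronise the empty stretches
      refine Or.inl ⟨hj0, Nat.one_le_iff_ne_zero.2 fun hi0 => ?_⟩
      subst hj0 hi0
      exact absurd (by simp) (hinit 0 0 hin (fun t ht => absurd ht (Nat.not_lt_zero t)) hEq)
    · rcases Nat.eq_zero_or_pos i with hi0 | hi1
      · -- passage through `c₀`
        exact Or.inr (Or.inl ⟨hi0, hj1⟩)
      · -- a merge: the predecessors are distinct by minimality of `j`
        have hne : cornerOrbit β₀ c₀ (i - 1) ≠ cornerOrbit β₁ c₁ (j - 1) := fun h' =>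
          hmin (j - 1) (Nat.sub_lt hj1 Nat.one_pos) (i - 1) (le_trans (Nat.sub_le i 1) hin) h'.symm
        have hnext : nextCorner β₀ (cornerOrbit β₀ c₀ (i - 1)) =
            nextCorner β₁ (cornerOrbit β₁ c₁ (j - 1)) := by
          have h' : cornerOrbit β₀ c₀ (i - 1 + 1) = cornerOrbit β₁ c₁ (j - 1 + 1) := by
            rw [Nat.sub_add_cancel hi1, Nat.sub_add_cancel hj1]
            exact hEq.symm
          exact h'
        obtain ⟨hcol, htgt, hst⟩ := hcollar _ _ hne hnext
        exact Or.inr (Or.inr ⟨hj1, hi1, hne, htgt, hst, hcol⟩)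
  · left
    exact fun j hj i hi h => hcontact ⟨j, hj, i, hi, h⟩

/-! ## The structure theorem of the INITIAL case -/

/-- **Structure of an INITIAL forward-response failure** (registered sub-goal `ufrs_initialStrands` of
stmt-CriticalPhenomena-11387; item 3 of the UFRS road map, INITIAL case). For `η > 0` there is `δ₀ > 0`
such that for every admissible datum `E` of `D` with `E.δ < δ₀`, shift `w` with `‖E.δ w‖ < η`, ball
`B(E.δ v, ρ)`, configuration `ω`, start corners `a` of `E` and `a'` of `shiftData E w`, and re-entry
time `n` of the `β₀`-orbit of `a` into the ball through inner faces with NO synchronised index `m ≤ n`: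
`a'` is the translate of `a`; the `β₁`-orbit of `a'` has a run end `T`; both stretches are simple; and
either they share no corner, or their first contact carries a turning offset `2πℓ ≠ 0` and is a
passage through a start corner or a merge of the two dynamics at a discrepancy edge of the
`3η`-collar of `∂D`. -/
theorem ufrs_initialStrands : ∀ (D : DobrushinDomain) (η : ℝ), 0 < η → ∃ δ₀ > (0:ℝ), ∀ E : DiscreteDobrushin, E.Ω = D.carrier → E.IsZdAdmissible → E.δ < δ₀ → ∀ (v w : Site 2) (ρ : ℝ), ‖meshPoint E.δ w‖ < η → ∀ (ω : BondConfig (Site 2)) (a a' : Site 2 × Fin 4) (n : ℕ), E.IsStartCorner a → (shiftData E w).IsStartCorner a' → (∀ i < n, medialPoint E.δ (cTgt (cornerOrbit (E.bcBondConfig ω) a i)) ∉ ball (meshPoint E.δ v) ρ ∧ E.IsInnerFace (cFace (cornerOrbit (E.bcBondConfig ω) a (i + 1)))) → medialPoint E.δ (cTgt (cornerOrbit (E.bcBondConfig ω) a n)) ∈ ball (meshPoint E.δ v) ρ → (∀ m k : ℕ, m ≤ n → (∀ i < k, medialPoint E.δ (cTgt (cornerOrbit ((shiftData E w).bcBondConfig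 ω) a' i)) ∉ ball (meshPoint E.δ v) ρ ∧ (shiftData E w).IsInnerFace (cFace (cornerOrbit ((shiftData E w).bcBondConfig ω) a' (i + 1)))) → cornerOrbit ((shiftData E w).bcBondConfig ω) a' k = cornerOrbit (E.bcBondConfig ω) a m → ∑ i ∈ Finset.range k, turnOf ((shiftData E w).bcBondConfig ω) (cornerOrbit ((shiftData E w).bcBondConfig ω) a' i) ≠ ∑ i ∈ Finset.range m, turnOf (E.bcBondConfig ω) (cornerOrbit (E.bcBondConfig ω) a i)) → a' = (a.1 + w, a.2) ∧ ∃ T : ℕ, (∀ i < T, medialPoint E.δ (cTgt (cornerOrbit ((shiftData E w).bcBondConfig ω) a' i)) ∉ ball (meshPoint E.δ v) ρ ∧ (shiftData E w).IsInnerFace (cFace (cornerOrbit ((shiftData E w).bcBondConfig ω) a' (i + 1)))) ∧ (medialPoint E.δ (cTgt (cornerOrbit ((shiftData E w).bcBondConfig ω) a' T)) ∈ ball (meshPoint E.δ v) ρ ∨ ¬ (shiftData E w).IsInnerFace (cFace (cornerOrbit ((shiftData E w).bcBondConfig ω) a' (T + 1)))) ∧ (∀ i j : ℕ, i ≤ n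 → j ≤ n → cornerOrbit (E.bcBondConfig ω) a i = cornerOrbit (E.bcBondConfig ω) a j → i = j) ∧ (∀ i j : ℕ, i ≤ T → j ≤ T → cornerOrbit ((shiftData E w).bcBondConfig ω) a' i = cornerOrbit ((shiftData E w).bcBondConfig ω) a' j → i = j) ∧ ((∀ j ≤ T, ∀ i ≤ n, cornerOrbit ((shiftData E w).bcBondConfig ω) a' j ≠ cornerOrbit (E.bcBondConfig ω) a i) ∨ (∃ (j i : ℕ) (ℓ : ℤ), j ≤ T ∧ i ≤ n ∧ cornerOrbit ((shiftData E w).bcBondConfig ω) a' j = cornerOrbit (E.bcBondConfig ω) a i ∧ (∀ j' < j, ∀ i' ≤ n, cornerOrbit ((shiftData E w).bcBondConfig ω) a' j' ≠ cornerOrbit (E.bcBondConfig ω) a i') ∧ ℓ ≠ 0 ∧ ∑ t ∈ Finset.range i, turnOf (E.bcBondConfig ω) (cornerOrbit (E.bcBondConfig ω) a t) - ∑ t ∈ Finset.range j, turnOf ((shiftData E w).bcBondConfig ω) (cornerOrbit ((shiftData E w).bcBondConfig ω) a' t) = 2 * Real.pi * ℓ ∧ ((j = 0 ∧ 1 ≤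 i) ∨ (i = 0 ∧ 1 ≤ j) ∨ (1 ≤ j ∧ 1 ≤ i ∧ cornerOrbit (E.bcBondConfig ω) a (i - 1) ≠ cornerOrbit ((shiftData E w).bcBondConfig ω) a' (j - 1) ∧ cTgt (cornerOrbit (E.bcBondConfig ω) a (i - 1)) = cTgt (cornerOrbit ((shiftData E w).bcBondConfig ω) a' (j - 1)) ∧ ¬ (cTgt (cornerOrbit (E.bcBondConfig ω) a (i - 1)) ∈ E.bcBondConfig ω ↔ cTgt (cornerOrbit (E.bcBondConfig ω) a (i - 1)) ∈ (shiftData E w).bcBondConfig ω) ∧ infDist (meshPoint E.δ (cornerOrbit (E.bcBondConfig ω) a (i - 1)).1) D.carrierᶜ < 3 * η)))) := by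
  intro D η hη
  obtain ⟨δ₀, hδ₀, hmerge⟩ := ufrs_mergeCollar D η hη
  refine ⟨δ₀, hδ₀, ?_⟩
  intro E hEΩ hE hEδ v w ρ hw ω a a' n ha ha' hStr hin hinit
  have hE₁ : (shiftData E w).IsZdAdmissible := isZdAdmissible_shiftData E w hE
  -- (1) the start corner of the translate
  have ha'eq : a' = (a.1 + w, a.2) := eq_shift_of_isStartCorner hE ha ha'
  -- (2) the run of the second dynamics from `a'` ends (no idle cycling)
  obtain ⟨T, hrun, hend⟩ := exists_runEnd ((shiftData E w).bcBondConfig ω) (shiftData E w).IsInnerFace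
    {e | medialPoint E.δ e ∈ ball (meshPoint E.δ v) ρ} a' 0 (finite_innerCorners hE₁)
    (fun p hp _ => nextCorner_ne_start hE₁ ha' hp) ha'.isOutEdge.1
    (fun i hi => absurd hi (Nat.not_lt_zero i))
  have hrun' : ∀ i < T, medialPoint E.δ (cTgt (cornerOrbit ((shiftData E w).bcBondConfig ω) a' i)) ∉
      ball (meshPoint E.δ v) ρ ∧
      (shiftData E w).IsInnerFace (cFace (cornerOrbit ((shiftData E w).bcBondConfig ω) a' (i + 1))) :=
    hrun
  have hend' : medialPoint E.δ (cTgt (cornerOrbit ((shiftData E w).bcBondConfig ω) a' T)) ∈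
      ball (meshPoint E.δ v) ρ ∨
      ¬ (shiftData E w).IsInnerFace (cFace (cornerOrbit ((shiftData E w).bcBondConfig ω) a' (T + 1))) :=
    hend
  -- (3) simplicity of the two stretches, (4) the first contact
  refine ⟨ha'eq, T, hrun', hend',
    fun i j hi hj h => cornerOrbit_injOn_stretch
      (I := {e | medialPoint E.δ e ∈ ball (meshPoint E.δ v) ρ}) (fun i hi => (hStr i hi).1) hin hi hj h,
    fun i j hi hj h => cornerOrbit_injOn_run
      (I := {e | medialPoint E.δ e ∈ ball (meshPoint E.δ v) ρ}) hrun' hend' hi hj h, ?_⟩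
  exact initialContact (I := {e | medialPoint E.δ e ∈ ball (meshPoint E.δ v) ρ})
    (In₁ := (shiftData E w).IsInnerFace)
    (Col := fun p => infDist (meshPoint E.δ p.1) D.carrierᶜ < 3 * η)
    (fun p p' hne h => hmerge E hEΩ hE hEδ w hw ω p p' hne h) (by rw [ha'eq]) hinit hrun'

end

end Summit.CriticalPhenomena.CardyFormulaZ2.Cruxes.EdgePrecompact.QkzStripBoundaryArm
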